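import Summits.FinalStateConjecture.FinalStateConjecture.Theorems.EIHFluxBalanceInertialRecessionStubRechart11Region
import Summits.FinalStateConjecture.FinalStateConjecture.Theorems.EIHFluxBalanceInertialRecessionStubRechart12Orient
import Summits.FinalStateConjecture.FinalStateConjecture.Theorems.EIHFluxBalanceInertialRecessionStubRechart12Profile
import Summits.FinalStateConjecture.FinalStateConjecture.Theorems.EIHFluxBalanceInertialRecessionStubRechart12Transfer
import Summits.FinalStateConjecture.FinalStateConjecture.Theorems.EIHFluxBalanceInertialRecessionStubRechart3Disjoint
import Summits.FinalStateConjecture.FinalStateConjecture.Theorems.EIHFluxBalanceInertialRecessionRechartAssembly2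
import Summits.FinalStateConjecture.FinalStateConjecture.Theorems.EIHFluxBalanceInertialRecessionFlatPackage

/-!
# Route EIHFluxBalance — `InertialRecession` (E′), re-charting on the given region: ASSEMBLY of the
# decomposition from the rest-frame clock charts (all spins)

Helper file for the crux `stmt-FinalStateConjecture-17403`
(`Summit.FinalStateConjecture.FinalStateConjecture.Theses.EIHFluxBalance.InertialRecession`, E′),
line `SketchCleanExcision`, stub `stub_rechartOnRegion` (P2′).

`exists_finalStateDecomposition_onRegion_of_clockCharts`: from the lab chart `Φ : U → 𝒟` with its
region `O = J⁺(ιX) ∩ I⁻(Φ(E))`, image, exhaustion and late-embedding clauses, eventual lab-time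
causality (T), future-orientation (Ofut) of `Φ` on a late predicate `Q`, and for every hole its
REST-FRAME clock chart `Ψᵢ = Φ ∘ Aᵢ` (…StubRechart3Package: smooth open embedding into `Φ(E)`,
fixed-radius `C²` convergence, eventual disjointness of the boosted tubes, honesty near late bounded
points, clock `T₀ᵢ`, frame `Λ̃ᵢ`) with its dictionary (…StubRechart12Clock: `θᵢ, βᵢ, Rrᵢ, Sᵢ`,
coverage stages, inner dictionary), final velocities `Vᵢ`, and the radiation-zone package for every
admissible flat profile, it assembles `d : FinalStateDecomposition 𝒟 O 2` ON THE GIVEN `O` with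
sub-extremal holes, `O = exteriorOf 𝒟 d.charted`, `HasExhaustiveCharts d`, `IsFutureOriented d`.
Route: profiles (…StubRechart12Profile) → flat package → transfer in the rest frames with lagged
time (…StubRechart12Transfer) → LAGGED BOOSTED charts `y ↦ Ψᵢ(Λᵢ⁻¹y)` on
`boostedKerrBackground Λᵢ (s Λᵢe₀) Mᵢ aᵢ`, `Λᵢ = boost(Vᵢ)` (…RechartLagBackground: images,
convergence, open embedding transported) → orientation (…StubRechart12Orient, …StubRechart11Orient)
→ `exists_finalStateDecomposition_onRegion_of_rechart'` (…StubRechart11Region). [folklore]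
-/

noncomputable section

set_option linter.dupNamespace false

open Set Filter Topology Function TopologicalSpace Literature.Geometry.Lorentzian
open Summit.FinalStateConjecture.FinalStateConjecture.Theorems.SublinearIsFree.Rechart
open scoped Manifold ContDiff ENNReal

namespace Summit.FinalStateConjecture.FinalStateConjecture.Theorems

/-- A sub-extremal hole has a positive horizon radius `r₊ = M + √(M² − a²) ≥ M > |a| ≥ 0`
(registered carrier `rPlus_pos_of_isSubextremal_rechart12` of the crux item). [folklore] -/
theorem rPlus_pos_of_isSubextremal_rechart12 : open Literature.Geometry.Lorentzian in ∀ {M a : ℝ}, Kerr.IsSubextremal M a → 0 < Kerr.rPlus M a := by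
  intro M a h
  have h1 : 0 < M := h.pos
  unfold Kerr.rPlus; linarith [Real.sqrt_nonneg (M ^ 2 - a ^ 2)]

section Assembly

variable {X : Type} [TopologicalSpace X] [ChartedSpace E3 X] [IsManifold (𝓡 3) ∞ X]
  [ConnectedSpace X] {D : InitialDataSet (𝓡 3) X} (𝒟 : VacuumCauchyDevelopment D)
  {N : ℕ} (M a : Fin N → ℝ) (hsub : ∀ i, Kerr.IsSubextremal (M i) (a i))
  (ξ : Fin N → ℝ → E3) (rpE : Fin N → E4 → ℝ) (hrpc : ∀ i, Continuous (rpE i))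
  (U : Opens E4) (Φ : U → 𝒟.carrier) (hΦ : ContMDiff 𝓘(ℝ, E4) (𝓡 4) ∞ Φ)
  (O : Set 𝒟.carrier) {τ₀ : ℝ}
  (hO : O = 𝒟.metric.causalFuture 𝒟.timeOrientation (range 𝒟.embed) ∩
    𝒟.metric.chronologicalPast 𝒟.timeOrientation
      (Φ '' {x : U | τ₀ < x.1 0 ∧ ∀ j, Kerr.rPlus (M j) (a j) < rpE j x.1}))
  (himO : Φ '' {x : U | τ₀ < x.1 0 ∧ ∀ j, Kerr.rPlus (M j) (a j) < rpE j x.1} ⊆ O)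
  (hexh : ∀ t₁ : ℝ, τ₀ < t₁ →
    O \ Φ '' {x : U | t₁ < x.1 0 ∧ ∀ j, Kerr.rPlus (M j) (a j) < rpE j x.1} ⊆
      𝒟.metric.causalPast 𝒟.timeOrientation
        (Φ '' {x : U | x.1 0 = t₁ ∧ ∀ j, Kerr.rPlus (M j) (a j) < rpE j x.1}))
  (hembΦ : IsOpenEmbedding (({x : U | τ₀ < x.1 0} : Set U).restrict Φ))
  {τT : ℝ}
  (hT : ∀ x x' : U, τT < x.1 0 → (∀ j, Kerr.rPlus (M j) (a j) < rpE j x.1) → τT < x'.1 0 →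
    (∀ j, Kerr.rPlus (M j) (a j) < rpE j x'.1) →
    Φ x' ∈ 𝒟.metric.causalFuture 𝒟.timeOrientation {Φ x} → x.1 0 ≤ x'.1 0)
  -- (Ofut)
  (Q : U → Prop) {TO : ℝ} (hQof : ∀ x : U, TO < x.1 0 → (∀ j, Kerr.rPlus (M j) (a j) < rpE j x.1) → Q x)
  (hOfut : ∀ x : U, Q x → ∀ w : E4, 0 < w 0 →
    𝒟.metric.val (Φ x) (mfderiv 𝓘(ℝ, E4) (𝓡 4) Φ x w) (mfderiv 𝓘(ℝ, E4) (𝓡 4) Φ x w) < 0 →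
      𝒟.timeOrientation.IsFutureDirected (mfderiv 𝓘(ℝ, E4) (𝓡 4) Φ x w))
  -- final velocities
  (V : Fin N → E3) (hV1 : ∀ i, ‖V i‖ < 1)
  -- rest charts
  (A : Fin N → E4 → E4) (hA : ∀ i, ContDiff ℝ ∞ (A i))
  (hAU : ∀ i, ∀ y ∈ boostedKerrExterior 1 0 (M i) (a i), A i y ∈ U)
  (hAlate : ∀ i (y : E4), τ₀ < A i y 0)
  (hAP : ∀ i, ∀ y ∈ boostedKerrExterior 1 0 (M i) (a i), ∀ j, Kerr.rPlus (M j) (a j) < rpE j (A i y))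
  (hQA : ∀ (i : Fin N) (y : E4) (hy : y ∈ boostedKerrExterior 1 0 (M i) (a i)), Q ⟨A i y, hAU i y hy⟩)
  (hψemb : ∀ i, IsOpenEmbedding
    (fun y : boostedKerrExterior 1 0 (M i) (a i) ↦ Φ ⟨A i y.1, hAU i y.1 y.2⟩))
  (hconvR : ∀ (i : Fin N) (R : ℝ), Tendsto (fun τ ↦ 𝒟.toSpacetime.truncDeviationCk
    (boostedKerrBackground 1 0 (M i) (a i))
    (fun y : boostedKerrExterior 1 0 (M i) (a i) ↦ Φ ⟨A i y.1, hAU i y.1 y.2⟩) 2 R τ) atTop (𝓝 0))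
  (hdisjB : ∀ i j, i ≠ j → ∀ R : ℝ, ∀ᶠ τ₁ in atTop, Disjoint
    (boostChart (Lorentz.boost (V i) (hV1 i)) (M i) (a i)
      (fun y : boostedKerrExterior 1 0 (M i) (a i) ↦ Φ ⟨A i y.1, hAU i y.1 y.2⟩) ''
        (boostedKerrBackground (Lorentz.boost (V i) (hV1 i)) 0 (M i) (a i)).truncLateRegion τ₁ R)
    (boostChart (Lorentz.boost (V j) (hV1 j)) (M j) (a j)
      (fun y : boostedKerrExterior 1 0 (M j) (a j) ↦ Φ ⟨A j y.1, hAU j y.1 y.2⟩) ''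
        (boostedKerrBackground (Lorentz.boost (V j) (hV1 j)) 0 (M j) (a j)).truncLateRegion τ₁ R))
  -- clock data (orientation of the hole charts)
  (Λt : Fin N → ℝ → lorentzGroup) (T₀ : Fin N → ℝ → ℝ)
  (hΛt : ∀ i, ContDiff ℝ ∞ (fun t ↦ ((Λt i t : E4 ≃L[ℝ] E4) : E4 →L[ℝ] E4)))
  (hξ : ∀ i, ContDiff ℝ ∞ (ξ i)) (hT₀s : ∀ i, ContDiff ℝ ∞ (T₀ i))
  (hclock : ∀ i τ, deriv (T₀ i) τ = frameVel (Λt i (T₀ i τ)) 0)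
  (hpos : ∀ i t, 0 < frameVel (Λt i t) 0)
  (hdecT : ∀ i, Tendsto (fun t ↦ deriv (fun s ↦ frameTilt (Λt i s)) t) atTop (𝓝 0))
  (htop : ∀ i, Tendsto (T₀ i) atTop atTop)
  (hhon : ∀ (i : Fin N) (K : ℝ), ∃ τK : ℝ, ∀ y : E4, τK ≤ y 0 → ‖E4.spatial y‖ ≤ K →
    A i =ᶠ[𝓝 y] honestChart (Λt i) (ξ i) (T₀ i))
  -- the dictionary
  (θ β Rr : Fin N → ℝ → ℝ) (S : Fin N → ℝ) (tcov : Fin N → ℕ → ℝ) (Tlab Bβ w w' : Fin N → ℝ)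
  (sL : ℝ) (hsL : 0 ≤ sL)
  (hθtop : ∀ i, Tendsto (θ i) atTop atTop) (hθle : ∀ i, ∀ᶠ t in atTop, θ i t ≤ t + sL)
  (hβ0 : ∀ i t, 0 ≤ β i t) (hβB : ∀ i t, β i t ≤ Bβ i) (hw : ∀ i, 0 ≤ w i)
  (hslack : ∀ i (n : ℕ), ∀ᶠ t in atTop, β i t * n ≤ (t - θ i t) + sL)
  (hRrm : ∀ i, Monotone (Rr i)) (hRrt : ∀ i, Tendsto (Rr i) atTop atTop)
  (hRrc : ∀ i, Tendsto (fun τ ↦ 𝒟.toSpacetime.truncDeviationCk (boostedKerrBackground 1 0 (M i) (a i))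
    (fun y : boostedKerrExterior 1 0 (M i) (a i) ↦ Φ ⟨A i y.1, hAU i y.1 y.2⟩) 2 (Rr i τ) τ) atTop (𝓝 0))
  (hreach : ∀ (i : Fin N) (y : boostedKerrExterior 1 0 (M i) (a i)) (τ₁ : ℝ), S i ≤ y.1 0 →
    y.1 0 ≤ τ₁ → Kerr.rPlus (M i) (a i) + 1 ≤ Kerr.radius (a i) y.1 →
    Kerr.radius (a i) y.1 ≤ Rr i (y.1 0) →
    Φ ⟨A i y.1, hAU i y.1 y.2⟩ ∈ 𝒟.metric.causalPast 𝒟.timeOrientation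
      ((fun y : boostedKerrExterior 1 0 (M i) (a i) ↦ Φ ⟨A i y.1, hAU i y.1 y.2⟩) ''
        {z | z.1 0 = τ₁ ∧ Kerr.radius (a i) z.1 ≤ Rr i τ₁}))
  (hcov : ∀ (i : Fin N) (n : ℕ) (x : E4), tcov i n ≤ x 0 → w i * n + w' i ≤ x 0 / 2 →
    Kerr.rPlus (M i) (a i) < rpE i x → rpE i x ≤ n →
    ∃ y : E4, A i y = x ∧ Kerr.radius (a i) y = rpE i x ∧ |y 0 - θ i (x 0)| ≤ β i (x 0) * rpE i x)
  (hlab : ∀ (i : Fin N) (y : E4), Tlab i ≤ A i y 0 → Kerr.radius (a i) y < Kerr.rPlus (M i) (a i) + 1 →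
    rpE i (A i y) = Kerr.radius (a i) y)
  -- painted radius versus lab distance; far points are exterior
  {Cγ R₀ : ℝ} (hCγ : 0 < Cγ) (hR₀ : 0 ≤ R₀)
  (hrpd : ∀ (i : Fin N) (x : E4), rpE i x ≤ Cγ * ‖E4.spatial x - ξ i (x 0)‖)
  (hfar : ∀ (x : E4) (i : Fin N), R₀ ≤ ‖E4.spatial x - ξ i (x 0)‖ → Kerr.rPlus (M i) (a i) < rpE i x)
  -- the flat package for every admissible profile
  (hflat : ∀ R' : ℝ → ℝ, Continuous R' → (∀ t, R₀ ≤ R' t) → Tendsto R' atTop atTop →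
    Tendsto (fun t ↦ R' t / t) atTop (𝓝 0) →
    ∃ (U₀ : Opens E4) (hU₀ : U₀ ≤ U) (ρ : Fin N → ℝ → ℝ),
      (U₀ : Set E4) = {x : E4 | max τ₀ 0 + 1 < x 0 ∧ ∀ i, R' (x 0) < ‖E4.spatial x - ξ i (x 0)‖} ∧
      (∀ i, Tendsto (fun t ↦ ρ i t / t) atTop (𝓝 0)) ∧
      {x : E4 | max τ₀ 0 + 1 < x 0 ∧ ∀ i, ρ i (x 0) <
        Kerr.radius (a i) (poincareInv (Lorentz.boost (V i) (hV1 i)) 0 x)} ⊆ (U₀ : Set E4) ∧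
      Tendsto (fun t ↦ 𝒟.toSpacetime.deviationCk (Minkowski.backgroundOn U₀) (Φ ∘ Opens.inclusion hU₀) 2 t)
        atTop (𝓝 0) ∧
      IsOpenEmbedding (((Minkowski.backgroundOn U₀).lateRegion (max τ₀ 0 + 1)).restrict
        (Φ ∘ Opens.inclusion hU₀)))

include hsub hrpc hΦ hO himO hexh hembΦ hT hQof hOfut hA hAlate hAP hQA hψemb hconvR hdisjB hΛt hξ hT₀s hclock
  hpos hdecT htop hhon hsL hθtop hθle hβ0 hβB hw hslack hRrm hRrt hRrc hreach hcov hlab hCγ hR₀ hrpd hfar hflat in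
-- long bookkeeping proof
set_option maxHeartbeats 1600000 in
/-- **The re-charted decomposition on the given region from the rest-frame clock charts.** See the
module docstring. [folklore] -/
theorem exists_finalStateDecomposition_onRegion_of_clockCharts :
    ∃ d : FinalStateDecomposition 𝒟.toSpacetime O 2,
      (∀ i, Kerr.IsSubextremal (d.mass i) (d.spin i)) ∧
        O = Summit.FinalStateConjecture.exteriorOf 𝒟.toCauchyDevelopment d.charted ∧
          Summit.FinalStateConjecture.HasExhaustiveCharts d ∧ Summit.FinalStateConjecture.IsFutureOriented d := by
  classical
  have hrp0 : ∀ i, 0 < Kerr.rPlus (M i) (a i) := fun i ↦ rPlus_pos_of_isSubextremal_rechart12 (hsub i)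
  -- ### notation: rest charts, lagged boosted charts
  set Pext : U → Prop := fun x ↦ ∀ j, Kerr.rPlus (M j) (a j) < rpE j x.1 with hPext
  set ψR : ∀ i, boostedKerrExterior 1 0 (M i) (a i) → 𝒟.carrier := fun i y ↦ Φ ⟨A i y.1, hAU i y.1 y.2⟩ with hψR
  set Λf : Fin N → lorentzGroup := fun i ↦ Lorentz.boost (V i) (hV1 i) with hΛf
  set cm : Fin N → E4 := fun i ↦ sL • (Λf i : E4 ≃L[ℝ] E4) (E4.basisVector 0) with hcm
  set Kb : Fin N → ModelBackground := fun i ↦ boostedKerrBackground (Λf i) (cm i) (M i) (a i) with hKb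
  have hAUl : ∀ i, ∀ y ∈ (Kb i).domain, A i ((Λf i : E4 ≃L[ℝ] E4).symm y) ∈ U := fun i y hy ↦
    hAU i _ (symm_mem_rest_of_mem_lag (Λf i) sL (M i) (a i) hy)
  set ψ : ∀ i, (Kb i).domain → 𝒟.carrier := fun i y ↦ Φ ⟨A i ((Λf i : E4 ≃L[ℝ] E4).symm y.1), hAUl i y.1 y.2⟩ with hψ
  have hψrel : ∀ i (y : (Kb i).domain), ψ i y =
      ψR i ⟨(Λf i : E4 ≃L[ℝ] E4).symm y.1, symm_mem_rest_of_mem_lag (Λf i) sL (M i) (a i) y.2⟩ := fun i y ↦ rfl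
  have hψRs : ∀ i, ContMDiff 𝓘(ℝ, E4) (𝓡 4) ∞ (ψR i) := fun i ↦
    contMDiff_comp_smooth (hA i) (hAU i) (fun _ ↦ rfl) hΦ
  have hRct : ∀ i, Tendsto (fun t ↦ Rr i (t + sL)) atTop atTop := fun i ↦
    (hRrt i).comp (tendsto_atTop_add_const_right atTop sL tendsto_id)
  -- ### profiles and the flat package
  set Sm : ℝ := ∑ j, |S j| with hSm
  have hBβ0 : ∀ i, 0 ≤ Bβ i := fun i ↦ (hβ0 i 0).trans (hβB i 0)
  obtain ⟨Rb, R', Tp, -, hRbt, hRbd, hRb0, hR'c, hR'0, hR't, hR'd, hprof⟩ :=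
    exists_transfer_profiles_r12 θ β Rr tcov Bβ w w' sL Sm R₀ Cγ hCγ hR₀ hθtop hβ0 hBβ0 hw hslack hRrm hRrt
  obtain ⟨U₀, hU₀, ρexc, hU₀eq, hexc, htube, hflatdev, hflatemb⟩ := hflat R' hR'c hR'0 hR't hR'd
  -- far points of `U₀` are exterior
  have hU₀P : ∀ x : U₀, ∀ j, Kerr.rPlus (M j) (a j) < rpE j x.1 := fun x j ↦ by
    have hx : (x.1 : E4) ∈ (U₀ : Set E4) := x.2
    rw [hU₀eq] at hx
    exact hfar x.1 j ((hR'0 _).trans (hx.2 j).le)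
  -- `O` is closed under `J⁺ ∩ J⁻(late image)`
  have hWo : IsOpen (Φ '' {x : U | τ₀ < x.1 0 ∧ Pext x}) :=
    isOpen_image_late_of_continuous hembΦ (fun j (x : U) ↦ rpE j x.1)
      (fun j ↦ (hrpc j).comp continuous_subtype_val) fun j ↦ Kerr.rPlus (M j) (a j)
  have hOcl : ∀ p ∈ O, ∀ z : 𝒟.carrier, z ∈ 𝒟.metric.causalFuture 𝒟.timeOrientation {p} →
      z ∈ 𝒟.metric.causalPast 𝒟.timeOrientation (Φ '' {x : U | τ₀ < x.1 0 ∧ Pext x}) → z ∈ O :=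
    fun p hp z hz hzW ↦ mem_exterior_of_causalFuture_of_causalPast 𝒟 hWo hO hp hz hzW
  -- ### the transfer in the rest frames with lagged time
  obtain ⟨τ₀', -, hτ, hτf, htr⟩ := clock_transfer_r12 M a hrp0 ξ rpE hrpc U Φ O hexh hT hOcl himO hembΦ sL hsL A
    hAU hAlate hψemb θ β Rr S tcov Tlab Bβ w w' hθtop hθle hβ0 hβB hRrm hreach hcov hlab Rb R' hCγ hRbt hRb0
    hprof hrpd U₀ hU₀ hU₀eq τ₀
  -- ### the lagged boosted charts
  have hψs : ∀ i, ContMDiff 𝓘(ℝ, E4) (𝓡 4) ∞ (ψ i) := fun i ↦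
    contMDiff_comp_smooth (f := fun z ↦ A i ((Λf i : E4 ≃L[ℝ] E4).symm z))
      ((hA i).comp (Λf i : E4 ≃L[ℝ] E4).symm.contDiff) (hAUl i) (fun _ ↦ rfl) hΦ
  have hψe : ∀ i, IsOpenEmbedding (ψ i) := fun i ↦
    isOpenEmbedding_lagChart (Λf i) sL (M i) (a i) (ψR i) (ψ i) (hψemb i) (hψrel i)
  have hψE : ∀ i, range (ψ i) ⊆ Φ '' {x : U | τ₀ < x.1 0 ∧ Pext x} := by
    rintro i _ ⟨y, rfl⟩
    exact ⟨⟨A i ((Λf i : E4 ≃L[ℝ] E4).symm y.1), hAUl i y.1 y.2⟩,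
      ⟨hAlate i _, hAP i _ (symm_mem_rest_of_mem_lag (Λf i) sL (M i) (a i) y.2)⟩, rfl⟩
  have hconvL : ∀ (i : Fin N) (Rr' : ℝ), Tendsto (fun τ ↦ 𝒟.toSpacetime.truncDeviationCk (Kb i) (ψ i) 2 Rr' τ)
      atTop (𝓝 0) := fun i Rr' ↦
    tendsto_truncDeviationCk_lag (Λf i) sL (M i) (a i) (ψR i) (ψ i) (hψrel i) (hψRs i) 2 (fun _ ↦ Rr')
      (hconvR i Rr')
  have hRcL : ∀ i, Tendsto (fun τ ↦ 𝒟.toSpacetime.truncDeviationCk (Kb i) (ψ i) 2 (Rr i (τ + sL)) τ) atTop (𝓝 0) :=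
    fun i ↦ tendsto_truncDeviationCk_lag (Λf i) sL (M i) (a i) (ψR i) (ψ i) (hψrel i) (hψRs i) 2 (Rr i) (hRrc i)
  -- eventual disjointness of the lagged tubes
  have hdisjL : ∀ Rr' : ℝ, ∃ τ₁ : ℝ, Pairwise (Function.onFun Disjoint fun i ↦
      ψ i '' (Kb i).truncLateRegion τ₁ Rr') := by
    intro Rr'
    refine exists_pairwise_disjoint_of_eventually (fun i τ₁ ↦ ψ i '' (Kb i).truncLateRegion τ₁ Rr')
      fun i j hij ↦ ?_
    have hset : ∀ (k : Fin N) (τ₁ : ℝ), ψ k '' (Kb k).truncLateRegion τ₁ Rr' =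
        boostChart (Λf k) (M k) (a k) (ψR k) ''
          (boostedKerrBackground (Λf k) 0 (M k) (a k)).truncLateRegion (τ₁ + sL) Rr' := by
      intro k τ₁
      have h := image_lagChart_eq_boostChart (Λf k) sL (M k) (a k) (ψR k) (ψ k) (hψrel k)
        (fun t r ↦ τ₁ < t ∧ r ≤ Rr')
      refine h.trans (congrArg _ (Set.ext fun y ↦ ?_))
      simp only [mem_setOf_eq, lt_sub_iff_add_lt]
      rfl
    have h := (tendsto_atTop_add_const_right atTop sL tendsto_id).eventually (hdisjB i j hij Rr')
    refine h.mono fun τ₁ hτ ↦ ?_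
    rw [hset, hset]
    exact hτ
  -- orientation
  have hmotO : ∀ i, Summit.FinalStateConjecture.IsOrthochronous (Λf i) := fun i ↦
    boost_apply_basisVector_zero_zero_pos (hV1 i)
  have hQAl : ∀ (i : Fin N) (y : (Kb i).domain), Q ⟨A i ((Λf i : E4 ≃L[ℝ] E4).symm y.1), hAUl i y.1 y.2⟩ :=
    fun i y ↦ hQA i _ (symm_mem_rest_of_mem_lag (Λf i) sL (M i) (a i) y.2)
  have hholeO : ∀ (i : Fin N) (ρ : ℝ), ∀ᶠ τ in atTop, ∀ y ∈ (Kb i).truncTimeSlab ρ τ,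
      𝒟.timeOrientation.IsFutureDirected (mfderiv 𝓘(ℝ, E4) (𝓡 4) (ψ i) y
        (((Λf i : lorentzGroup) : E4 ≃L[ℝ] E4) (Kerr.timeVector (M i) (a i) (poincareInv (Λf i) (cm i) (y : E4))))) :=
    fun i ρ ↦ eventually_isFutureDirected_lagClockChart U Φ Q hΦ hOfut (Λf i) sL (hsub i) (Λt i) (ξ i) (T₀ i)
      (hΛt i) (hξ i) (hT₀s i) (hclock i) (hpos i) (hdecT i) (htop i) (hA i) (hhon i) (hAUl i) (hQAl i)
      (hRct i) (hRcL i) ρ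
  have hflatO : ∀ᶠ τ in atTop, ∀ x ∈ (Minkowski.backgroundOn U₀).timeSlab τ,
      𝒟.timeOrientation.IsFutureDirected
        (mfderiv 𝓘(ℝ, E4) (𝓡 4) (Φ ∘ Opens.inclusion hU₀) x (E4.basisVector 0)) :=
    eventually_isFutureDirected_flatChart U Φ Q hΦ hOfut U₀ hU₀ (TQ := TO)
      (fun x hx ↦ hQof _ hx (hU₀P x)) hflatdev
  -- the flat clauses at chart time `τ₀'`
  have htube' : {x : E4 | τ₀' < x 0 ∧ ∀ i, ρexc i (x 0) <
      Kerr.radius (a i) (poincareInv (Λf i) (cm i) x)} ⊆ (U₀ : Set E4) := by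
    intro x hx
    refine htube ⟨hτf.trans hx.1, fun i ↦ ?_⟩
    have h := hx.2 i
    have hrad : Kerr.radius (a i) (poincareInv (Λf i) (cm i) x) =
        Kerr.radius (a i) (poincareInv (Λf i) 0 x) := by
      rw [hcm, poincareInv_lag, poincareInv_zero]
      exact Kerr.radius_eq_of_spatial_eq _ (spatial_sub_smul_basisVector_zero _ _)
    rwa [hrad] at h
  have hflatemb' : IsOpenEmbedding (((Minkowski.backgroundOn U₀).lateRegion τ₀').restrict
      (Φ ∘ Opens.inclusion hU₀)) :=
    isOpenEmbedding_restrict_late_mono (W := U₀) hτf.le hflatemb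
  -- ### the transfer in the lagged charts
  have hcert : ∀ (i : Fin N) (τ₁ : ℝ),
      ψ i '' {y | τ₁ < (Kb i).time y.1 ∧ (Kb i).radius y.1 ≤ Rr i ((Kb i).time y.1 + sL)} =
        ψR i '' {y | τ₁ < y.1 0 - sL ∧ Kerr.radius (a i) y.1 ≤ Rr i (y.1 0 - sL + sL)} :=
    fun i τ₁ ↦ image_lagChart_eq_rest (Λf i) sL (M i) (a i) (ψR i) (ψ i) (hψrel i)
      (fun t r ↦ τ₁ < t ∧ r ≤ Rr i (t + sL))
  have hslab : ∀ (i : Fin N) (τ₁ : ℝ), ψ i '' (Kb i).truncTimeSlab (Rr i (τ₁ + sL)) τ₁ =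
      ψR i '' {y | y.1 0 - sL = τ₁ ∧ Kerr.radius (a i) y.1 ≤ Rr i (τ₁ + sL)} :=
    fun i τ₁ ↦ image_lagChart_eq_rest (Λf i) sL (M i) (a i) (ψR i) (ψ i) (hψrel i)
      (fun t r ↦ t = τ₁ ∧ r ≤ Rr i (τ₁ + sL))
  have htransfer : ∀ τ₁ : ℝ, τ₀' ≤ τ₁ →
      O ⊆ ((Φ ∘ Opens.inclusion hU₀) '' {x : U₀ | τ₁ < x.1 0} ∪
          ⋃ i, ψ i '' {y | τ₁ < (Kb i).time y.1 ∧ (Kb i).radius y.1 ≤ Rr i ((Kb i).time y.1 + sL)}) ∪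
        𝒟.metric.causalPast 𝒟.timeOrientation
          ((Φ ∘ Opens.inclusion hU₀) '' {x : U₀ | x.1 0 = τ₁} ∪
            ⋃ i, ψ i '' (Kb i).truncTimeSlab (Rr i (τ₁ + sL)) τ₁) := by
    intro τ₁ hτ₁
    have h1 : (⋃ i, ψ i '' {y | τ₁ < (Kb i).time y.1 ∧ (Kb i).radius y.1 ≤ Rr i ((Kb i).time y.1 + sL)}) =
        ⋃ i, ψR i '' {y | τ₁ < y.1 0 - sL ∧ Kerr.radius (a i) y.1 ≤ Rr i (y.1 0 - sL + sL)} :=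
      iUnion_congr fun i ↦ hcert i τ₁
    have h2 : (⋃ i, ψ i '' (Kb i).truncTimeSlab (Rr i (τ₁ + sL)) τ₁) =
        ⋃ i, ψR i '' {y | y.1 0 - sL = τ₁ ∧ Kerr.radius (a i) y.1 ≤ Rr i (τ₁ + sL)} :=
      iUnion_congr fun i ↦ hslab i τ₁
    rw [h1, h2]
    exact htr τ₁ hτ₁
  -- ### assembly
  exact exists_finalStateDecomposition_onRegion_of_rechart' 𝒟 M a hsub (fun i ↦ (Λf i, cm i)) U Φ hΦ O Pext hτ
    hO himO ψ hψs hψe hψE hconvL (fun i t ↦ Rr i (t + sL)) hRcL hdisjL hmotO hholeO U₀ hU₀ ρexc hexc htube'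
    hflatdev hflatemb' (fun x hx ↦ hU₀P x) hflatO htransfer

end Assembly

end Summit.FinalStateConjecture.FinalStateConjecture.Theorems

end
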